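/-
Copyright: seat `ym-line-cbag-p2` (prover-ym-line-cbag-p2-g2-0), route `ColdBoxAllGroups`, crux `BulkAllGroups`
(stmt-QuantumFields-22255), line `dlr-chessboard-G` (skeleton `Cruxes/BulkAllGroups/Lines/birth.lean` v5).
-/
import Summits.QuantumFields.YangMills.Theorems.ColdBoxAllGroupsOneScaleDatumDefsG
import Summits.QuantumFields.YangMills.Theorems.ColdBoxAllGroupsBoxFloorAllGroupsRepresentationGaussG
import Summits.QuantumFields.YangMills.Theorems.ColdBoxAllGroupsBoxFloorAllGroupsTiltBoundG
import Summits.QuantumFields.YangMills.Theorems.WeakCouplingRatesColdBoxDatumSplit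

/-!
# Crux `BulkAllGroups` (stmt-QuantumFields-22255), stubs `stub_kernelCovExpansionG` / `stub_kernelMeanExpansionG`: the one-scale expansion
# with an exterior datum in the exponential chart — the SPLIT IDENTITIES (T2a/T2b) and the DENSITY IDENTITY with datum

`G`-generic port of `Theorems/WeakCouplingRatesColdBoxDatumSplit.lean` (the `SU(2)` ϑ-datum pass of the proved crux `BulkDominatesColdBoxW`,
gnomonic chart, three colours, scale `√(2β)`) in the vocabulary of `Theorems/ColdBoxAllGroupsOneScaleDatumDefsG.lean` (`datVec`, `sdatE`
(scale `√β`), `meanTE`, `chartCfgDE`, `cfgTDE`, `qObsDE`, `goodTDE`, `tiltWDE`; `D = dimE ρ` colours, exponential chart `expChart ρ`).  The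
group-free identities of the `SU(2)` file (`formM_dir_eq_sum_touching_add` = T2b: the pinned Maxwell form of the enlarged box with datum splits
off an `s`-independent constant; `sCirc_glue_dir_congr_of_not_touching`; `dirFreeEquiv_symm_eq`) are reused by import.  New here:

* `sqrt_mul_extDatum_unscaleTE_eq` (**T2a edgewise**) — on every edge of the enlarged box,
  `√β · (extDatum (datVec ϑ) (unscaleTE H D β s) e)_c = glue ϑ'_c (s_c) e` (`ϑ' = sdatE β ϑ`), provided `ϑ = 0` on the temporal forest;
  `sqrt_mul_sCirc_extDatum_eqE` (**T2a**) — on a plaquette all of whose edges lie in the enlarged box,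
  `√β · sCirc(colour c of the chart data of cfgTDE t)(p) = sCirc(glue ϑ'_c (mean ϑ'_c + t_c))(p)`; squared and summed over the colours on a
  plaquette touching the cold box: `β · Σ_c sCirc(chart data_c)(p)² = 2·qObsDE p t` (`beta_mul_sum_sCirc_extDatum_sq_eqE`), i.e. the squared
  Euclidean norm of the LINEAR circulation of the chart coordinates is `2·qObsDE p t / β` (`norm_sq_circ_extDatum_unscaleTE`);
* `sum_qObsDE_eq` — completing the square colour by colour: `Σ_{q touching} qObsDE q t = ½ Σ_c t_cᵀ Q_D t_c + K₀(β,H,ϑ)`, hence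
  `Π_c gaussWeight_{Q_D}(t_c) = exp(−Σ_{q touching} qObsDE q t + K₀)` (`prod_gaussWeight_eq_exp_qObsDE`);
* `exists_boltzmann_mul_density_datum_eq` — **the density identity with datum** for a chart density `g` (a PARAMETER, as in the flat
  `boltzmann_mul_density_eq`): there is `C = C(β,H,ϑ) ∈ (0,∞)` with, for every centred colour tuple `t` at which `g > 0` on the free links,
  `e^{−β S_Λ(cfgTDE t)} · Π_{e free} g(a_e) = C · Π_c gaussWeight_{Q_D}(t_c) · e^{tiltWDE t}`, `a = unscaleTE H D β (t + μ')` (the mean shift sits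
  inside `cfgTDE`; the Gaussian reference stays the UNshifted `gaussD H D`; `C = e^{−K₀}` cancels in normalised expectations).
No sorry; no new definition; standard axioms.  NOT a claim about the mass gap: rung-level support (R2xi-G `XiPow`, RECORD label); the
Yang–Mills mass gap is NOT proved by any of this.
-/

set_option autoImplicit false

noncomputable section

open MeasureTheory Finset
open scoped ENNReal Matrix
open Literature.Probability.LatticeModels (Site halfOpenBox)
open Literature.MathematicalPhysics.QuantumLattice
open Literature.MathematicalPhysics.QuantumFieldTheory
open Literature.MathematicalPhysics.QuantumFieldTheory.LatticeMaxwell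
open Literature.MathematicalPhysics.QuantumFieldTheory.AxialGauge
open Literature.MathematicalPhysics.QuantumFieldTheory.GaussianToolkit
open Summit.QuantumFields.YangMills.Theorems.WeakCouplingRates
open Summit.QuantumFields.YangMills.Theorems.FreeEnergyLogCoefficient

namespace Summit.QuantumFields.YangMills.Theorems.ColdBoxAllGroups

variable {H : ℕ}

/-! ## T2a — the circulation split: chart circulations with datum are (background + fluctuation)/√β -/

/-- **Edgewise form of T2a** (exponential chart, scale `√β`): on every edge of the enlarged box,
`√β · (extDatum (datVec ϑ) (unscaleTE H D β s) e)_c = glue ϑ'_c (s_c) e` (`ϑ' = sdatE β ϑ`), provided `ϑ` vanishes on the temporal forest. -/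
theorem sqrt_mul_extDatum_unscaleTE_eq {D : ℕ} {β : ℝ} (hβ : 0 < β)
    (ϑ : Fin D → (Literature.MathematicalPhysics.QuantumLattice.ZdEdge 4 → ℝ))
    (hforest : ∀ x : Site 4, (∀ k : Fin 4, 1 ≤ x k ∧ x k + 1 ≤ 2 * (H : ℤ)) → ∀ c, ϑ c (x, 0) = 0)
    (s : TSpaceD H D) (c : Fin D) {e : Literature.MathematicalPhysics.QuantumLattice.ZdEdge 4}
    (he : e ∈ boxEdgesAt dirCorner (2 * H + 3)) :
    Real.sqrt β * extDatum (datVec ϑ) (unscaleTE H D β s) e c =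
      glue (pin := fun e => e ∉ dirFreeEdges H) dirCorner (2 * H + 3) (sdatE β ϑ c) (WithLp.ofLp (s c)) e := by
  have hc : Real.sqrt β ≠ 0 := (Real.sqrt_pos.2 hβ).ne'
  by_cases hΛ : e ∈ boxEdges 4 (2 * H + 1)
  · by_cases hf : (e.2 = 0 ∧ ∀ k : Fin 4, 1 ≤ e.1 k ∧ e.1 k + 1 ≤ 2 * (H : ℤ))
    · -- forest edge: both sides vanish
      obtain ⟨x, j⟩ := e
      obtain ⟨hj, hx⟩ := hf
      simp only at hj hx
      subst hj
      have hpin : (x, (0 : Fin 4)) ∉ dirFreeEdges H := fun hmem => (mem_dirFreeEdges.1 hmem).2 ⟨rfl, by exact_mod_cast hx⟩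
      rw [extDatum_of_forest _ _ hx, glue_apply_pin _ _ he hpin, sdatE_apply, hforest x hx c]
      simp
    · -- free edge
      have hfree : e ∈ dirFreeEdges H := mem_dirFreeEdges.2 ⟨hΛ, by simpa using hf⟩
      have key : extDatum (datVec ϑ) (unscaleTE H D β s) e c = unscaleTE H D β s ⟨⟨e, hΛ⟩, hf⟩ c := by
        have := extDatum_apply_free (datVec ϑ) (unscaleTE H D β s) ⟨⟨e, hΛ⟩, hf⟩
        rw [this]
      rw [key, unscaleTE_apply, dirFreeEquiv_symm_eq e hΛ hf,
        glue_apply_free (sdatE β ϑ c) (WithLp.ofLp (s c)) ⟨⟨e, he⟩, not_not.2 hfree⟩]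
      field_simp
  · -- exterior edge of the enlarged box: the datum
    have hpin : e ∉ dirFreeEdges H := fun hmem => hΛ (mem_dirFreeEdges.1 hmem).1
    rw [extDatum_of_not_mem _ _ hΛ, glue_apply_pin _ _ he hpin, sdatE_apply, datVec_apply]

/-- **T2a — the circulation split** (exponential chart): on a plaquette all of whose edges lie in the enlarged box, the chart circulation of
`cfgTDE`'s data is `(background + fluctuation)/√β`:
`√β · sCirc (colour c of extDatum (datVec ϑ) (unscaleTE β (t + μ'))) p = sCirc (glue ϑ'_c (mean ϑ'_c + t_c)) p`. -/
theorem sqrt_mul_sCirc_extDatum_eqE {D : ℕ} {β : ℝ} (hβ : 0 < β)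
    (ϑ : Fin D → (Literature.MathematicalPhysics.QuantumLattice.ZdEdge 4 → ℝ))
    (hforest : ∀ x : Site 4, (∀ k : Fin 4, 1 ≤ x k ∧ x k + 1 ≤ 2 * (H : ℤ)) → ∀ c, ϑ c (x, 0) = 0)
    (t : TSpaceD H D) (c : Fin D) {p : Plaq 4}
    (hp : (p.1, p.2.1) ∈ boxEdgesAt dirCorner (2 * H + 3) ∧ (p.1 + Pi.single p.2.1 1, p.2.2) ∈ boxEdgesAt dirCorner (2 * H + 3) ∧
      (p.1 + Pi.single p.2.2 1, p.2.1) ∈ boxEdgesAt dirCorner (2 * H + 3) ∧ (p.1, p.2.2) ∈ boxEdgesAt dirCorner (2 * H + 3)) :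
    Real.sqrt β * sCirc (fun e => extDatum (datVec ϑ) (unscaleTE H D β (t + meanTE H D β ϑ)) e c) p =
      sCirc (glue (pin := fun e => e ∉ dirFreeEdges H) dirCorner (2 * H + 3) (sdatE β ϑ c)
        (mean (fun e => e ∉ dirFreeEdges H) dirCorner (2 * H + 3) (sdatE β ϑ c) + WithLp.ofLp (t c))) p := by
  obtain ⟨h1, h2, h3, h4⟩ := hp
  have hs : WithLp.ofLp ((t + meanTE H D β ϑ) c) =
      mean (fun e => e ∉ dirFreeEdges H) dirCorner (2 * H + 3) (sdatE β ϑ c) + WithLp.ofLp (t c) := by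
    rw [Pi.add_apply, WithLp.ofLp_add, meanTE_apply, add_comm]
  rw [← hs]
  simp only [sCirc, mul_sub, mul_add, sqrt_mul_extDatum_unscaleTE_eq hβ ϑ hforest _ c h1,
    sqrt_mul_extDatum_unscaleTE_eq hβ ϑ hforest _ c h2, sqrt_mul_extDatum_unscaleTE_eq hβ ϑ hforest _ c h3,
    sqrt_mul_extDatum_unscaleTE_eq hβ ϑ hforest _ c h4]

/-- The four edges of a plaquette touching the cold box lie in the enlarged box (repackaged from `plaquetteEdges_subset_enlarged`). -/
theorem touching_edges_mem_enlarged {p : ZdPlaquette 4} (hp : p ∈ plaquettesTouching (boxEdges 4 (2 * H + 1))) :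
    ((p.1, p.2.1.1) ∈ boxEdgesAt dirCorner (2 * H + 3) ∧
      (p.1 + Pi.single p.2.1.1 1, p.2.1.2) ∈ boxEdgesAt dirCorner (2 * H + 3) ∧
      (p.1 + Pi.single p.2.1.2 1, p.2.1.1) ∈ boxEdgesAt dirCorner (2 * H + 3) ∧ (p.1, p.2.1.2) ∈ boxEdgesAt dirCorner (2 * H + 3)) :=
  ⟨plaquetteEdges_subset_enlarged hp (by simp [plaquetteEdges]), plaquetteEdges_subset_enlarged hp (by simp [plaquetteEdges]),
    plaquetteEdges_subset_enlarged hp (by simp [plaquetteEdges]), plaquetteEdges_subset_enlarged hp (by simp [plaquetteEdges])⟩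

/-- T2a for a plaquette touching the cold box, squared and summed over the colours: `β · Σ_c sCirc(chart data_c)(p)² = 2·qObsDE p t`. -/
theorem beta_mul_sum_sCirc_extDatum_sq_eqE {D : ℕ} {β : ℝ} (hβ : 0 < β)
    (ϑ : Fin D → (Literature.MathematicalPhysics.QuantumLattice.ZdEdge 4 → ℝ))
    (hforest : ∀ x : Site 4, (∀ k : Fin 4, 1 ≤ x k ∧ x k + 1 ≤ 2 * (H : ℤ)) → ∀ c, ϑ c (x, 0) = 0)
    (t : TSpaceD H D) {p : ZdPlaquette 4} (hp : p ∈ plaquettesTouching (boxEdges 4 (2 * H + 1))) :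
    β * ∑ c, (sCirc (fun e => extDatum (datVec ϑ) (unscaleTE H D β (t + meanTE H D β ϑ)) e c) (p.1, p.2.1.1, p.2.1.2)) ^ 2 =
      2 * qObsDE H D β ϑ (p.1, p.2.1.1, p.2.1.2) t := by
  have hE := touching_edges_mem_enlarged hp
  have h2 : β = Real.sqrt β ^ 2 := (Real.sq_sqrt hβ.le).symm
  rw [qObsDE, Finset.mul_sum, ← mul_assoc, show (2 : ℝ) * (1 / 2) = 1 by norm_num, one_mul]
  refine Finset.sum_congr rfl fun c _ => ?_
  rw [← sqrt_mul_sCirc_extDatum_eqE hβ ϑ hforest t c (p := ((p.1, p.2.1.1, p.2.1.2) : Plaq 4)) hE, mul_pow, ← h2]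

/-- **The linear circulation of the chart coordinates with datum is the shifted Dirichlet circulation, unscaled**: on a plaquette touching
the cold box, for `v = extDatum (datVec ϑ) (unscaleTE H D β (t + μ'))` and `β > 0`,
`‖v(x,i) + v(x+eᵢ,j) − v(x+eⱼ,i) − v(x,j)‖² = 2·qObsDE H D β ϑ (x,i,j) t / β`. -/
theorem norm_sq_circ_extDatum_unscaleTE {D : ℕ} {β : ℝ} (hβ : 0 < β)
    (ϑ : Fin D → (Literature.MathematicalPhysics.QuantumLattice.ZdEdge 4 → ℝ))
    (hforest : ∀ x : Site 4, (∀ k : Fin 4, 1 ≤ x k ∧ x k + 1 ≤ 2 * (H : ℤ)) → ∀ c, ϑ c (x, 0) = 0)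
    (t : TSpaceD H D) {p : ZdPlaquette 4} (hp : p ∈ plaquettesTouching (boxEdges 4 (2 * H + 1))) :
    ‖extDatum (datVec ϑ) (unscaleTE H D β (t + meanTE H D β ϑ)) (p.1, p.2.1.1) +
        extDatum (datVec ϑ) (unscaleTE H D β (t + meanTE H D β ϑ)) (p.1 + Pi.single p.2.1.1 1, p.2.1.2) -
        extDatum (datVec ϑ) (unscaleTE H D β (t + meanTE H D β ϑ)) (p.1 + Pi.single p.2.1.2 1, p.2.1.1) -
        extDatum (datVec ϑ) (unscaleTE H D β (t + meanTE H D β ϑ)) (p.1, p.2.1.2)‖ ^ 2 =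
      2 * qObsDE H D β ϑ (p.1, p.2.1.1, p.2.1.2) t / β := by
  rw [norm_sq_circ_eq_sum, ← beta_mul_sum_sCirc_extDatum_sq_eqE hβ ϑ hforest t hp, mul_div_cancel_left₀ _ hβ.ne']

/-! ## The quadratic surrogates with datum sum to the centred Gaussian exponent plus a constant -/

/-- **Completing the square, summed over the touching plaquettes** (`D` colours):
`Σ_{q touching Λ} qObsDE q t = ½ Σ_c t_cᵀ Q_D t_c + K₀(β,H,ϑ)` with the `t`-independent constant
`K₀ = ½ Σ_c (K_{ϑ'_c} − (M_{ϑ'_c}(0) − Σ_{q touching} sCirc(glue ϑ'_c 0)(q)²))`. -/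
theorem sum_qObsDE_eq {D : ℕ} (β : ℝ) (ϑ : Fin D → (Literature.MathematicalPhysics.QuantumLattice.ZdEdge 4 → ℝ)) (t : TSpaceD H D) :
    ∑ q ∈ plaquettesTouching (boxEdges 4 (2 * H + 1)), qObsDE H D β ϑ (q.1, q.2.1.1, q.2.1.2) t =
      (∑ c, (WithLp.ofLp (t c) ⬝ᵥ Qmat (fun e => e ∉ dirFreeEdges H) dirCorner (2 * H + 3) *ᵥ WithLp.ofLp (t c)) / 2) +
        (∑ c, (Kconst (fun e => e ∉ dirFreeEdges H) dirCorner (2 * H + 3) (sdatE β ϑ c) -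
          (formM (fun e => e ∉ dirFreeEdges H) dirCorner (2 * H + 3) (sdatE β ϑ c) 0 -
            ∑ p ∈ plaquettesTouching (boxEdges 4 (2 * H + 1)),
              (sCirc (glue (pin := fun e => e ∉ dirFreeEdges H) dirCorner (2 * H + 3) (sdatE β ϑ c) 0) (p.1, p.2.1.1, p.2.1.2)) ^ 2))) / 2 := by
  -- swap the sums
  have hswap : ∑ q ∈ plaquettesTouching (boxEdges 4 (2 * H + 1)), qObsDE H D β ϑ (q.1, q.2.1.1, q.2.1.2) t =
      ∑ c, (∑ q ∈ plaquettesTouching (boxEdges 4 (2 * H + 1)),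
        (sCirc (glue (pin := fun e => e ∉ dirFreeEdges H) dirCorner (2 * H + 3) (sdatE β ϑ c)
          (mean (fun e => e ∉ dirFreeEdges H) dirCorner (2 * H + 3) (sdatE β ϑ c) + WithLp.ofLp (t c))) (q.1, q.2.1.1, q.2.1.2)) ^ 2) / 2 := by
    simp only [qObsDE, Finset.mul_sum]
    rw [Finset.sum_comm]
    refine Finset.sum_congr rfl fun c _ => ?_
    rw [Finset.sum_div]
    exact Finset.sum_congr rfl fun q _ => by ring
  rw [hswap, ← Finset.sum_div, ← Finset.sum_div, ← add_div, ← Finset.sum_add_distrib]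
  congr 1
  refine Finset.sum_congr rfl fun c _ => ?_
  -- one colour: T2b + completing the square at `s = μ + t_c`
  have hsq := formM_eq_sq_of_posDef (posDef_dirQmat H) (sdatE β ϑ c)
    (mean (fun e => e ∉ dirFreeEdges H) dirCorner (2 * H + 3) (sdatE β ϑ c) + WithLp.ofLp (t c))
  rw [add_sub_cancel_left] at hsq
  have hsplit := formM_dir_eq_sum_touching_add (H := H) (sdatE β ϑ c)
    (mean (fun e => e ∉ dirFreeEdges H) dirCorner (2 * H + 3) (sdatE β ϑ c) + WithLp.ofLp (t c))
  linarith

/-- The product of the one-colour Gaussian weights in terms of the surrogates with datum: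
`Π_c gaussWeight_{Q_D}(t_c) = exp(−Σ_{q touching} qObsDE q t + K₀)`. -/
theorem prod_gaussWeight_eq_exp_qObsDE {D : ℕ} (β : ℝ) (ϑ : Fin D → (Literature.MathematicalPhysics.QuantumLattice.ZdEdge 4 → ℝ))
    (t : TSpaceD H D) :
    ∏ i, gaussWeight (Qmat (fun e => e ∉ dirFreeEdges H) dirCorner (2 * H + 3)) (t i) =
      ENNReal.ofReal (Real.exp (-(∑ q ∈ plaquettesTouching (boxEdges 4 (2 * H + 1)), qObsDE H D β ϑ (q.1, q.2.1.1, q.2.1.2) t) +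
        (∑ c, (Kconst (fun e => e ∉ dirFreeEdges H) dirCorner (2 * H + 3) (sdatE β ϑ c) -
          (formM (fun e => e ∉ dirFreeEdges H) dirCorner (2 * H + 3) (sdatE β ϑ c) 0 -
            ∑ p ∈ plaquettesTouching (boxEdges 4 (2 * H + 1)),
              (sCirc (glue (pin := fun e => e ∉ dirFreeEdges H) dirCorner (2 * H + 3) (sdatE β ϑ c) 0) (p.1, p.2.1.1, p.2.1.2)) ^ 2))) / 2)) := by
  simp only [gaussWeight]
  rw [← ENNReal.ofReal_prod_of_nonneg (fun i _ => (Real.exp_pos _).le), ← Real.exp_sum]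
  congr 2
  rw [sum_qObsDE_eq]
  simp only [neg_div, Finset.sum_neg_distrib]
  ring

/-! ## The density identity with datum -/

section Density

variable {N : ℕ} {G : Type} [Group G] (ρ : G →* Matrix (Fin N) (Fin N) ℂ)

/-- The real form of the density identity with datum: pointwise in `t`, for a density `g > 0` at the unscaled free links `a = unscaleTE (t + μ')`,
`e^{−β S_Λ(cfgTDE t)} · Π_e g(a_e) = exp(−Σ_touching qObsDE q t) · e^{tiltWDE t}`. -/
theorem boltzmann_mul_density_datum_eq_real (g : EuclideanSpace ℝ (Fin (dimE ρ)) → ℝ) (β : ℝ)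
    (ϑ : Fin (dimE ρ) → (Literature.MathematicalPhysics.QuantumLattice.ZdEdge 4 → ℝ)) (t : TSpaceD H (dimE ρ))
    (hg : ∀ e : ColdFreeIdx H, 0 < g (unscaleTE H (dimE ρ) β (t + meanTE H (dimE ρ) β ϑ) e)) :
    Real.exp (-β * wilsonBoundaryAction ρ (boxEdges 4 (2 * H + 1)) (cfgTDE ρ H β ϑ t)) *
        ∏ e : ColdFreeIdx H, g (unscaleTE H (dimE ρ) β (t + meanTE H (dimE ρ) β ϑ) e) =
      Real.exp (-(∑ q ∈ plaquettesTouching (boxEdges 4 (2 * H + 1)), qObsDE H (dimE ρ) β ϑ (q.1, q.2.1.1, q.2.1.2) t)) *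
        Real.exp (tiltWDE ρ H g β ϑ t) := by
  have hJ : Real.exp (∑ e : ColdFreeIdx H, Real.log (g (unscaleTE H (dimE ρ) β (t + meanTE H (dimE ρ) β ϑ) e))) =
      ∏ e : ColdFreeIdx H, g (unscaleTE H (dimE ρ) β (t + meanTE H (dimE ρ) β ϑ) e) := by
    rw [Real.exp_sum]
    exact Finset.prod_congr rfl fun e _ => Real.exp_log (hg e)
  have hexp : Real.exp (-(∑ q ∈ plaquettesTouching (boxEdges 4 (2 * H + 1)), qObsDE H (dimE ρ) β ϑ (q.1, q.2.1.1, q.2.1.2) t)) *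
      Real.exp (∑ q ∈ plaquettesTouching (boxEdges 4 (2 * H + 1)),
        (qObsDE H (dimE ρ) β ϑ (q.1, q.2.1.1, q.2.1.2) t - β * plaqCostAt ρ q.1 q.2.1.1 q.2.1.2 (cfgTDE ρ H β ϑ t))) =
      Real.exp (-β * ∑ q ∈ plaquettesTouching (boxEdges 4 (2 * H + 1)), plaqCostAt ρ q.1 q.2.1.1 q.2.1.2 (cfgTDE ρ H β ϑ t)) := by
    rw [← Real.exp_add]
    congr 1
    rw [neg_mul, Finset.mul_sum, Finset.sum_sub_distrib]
    ring
  rw [wilsonBoundaryAction_eq_sum_plaqCostAt_G, tiltWDE, Real.exp_add, hJ, ← hexp]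
  ring

/-- **The density identity with datum** (exponential chart, density `g` a parameter): there is a constant `C = C(β,H,ϑ) ∈ (0,∞)` with, for
every centred colour tuple `t` at which `g > 0` on the free links,
`e^{−β S_Λ(cfgTDE t)} · Π_{e free} g((t+μ')_e/√β) = C · Π_c gaussWeight_{Q_D}(t_c) · e^{tiltWDE t}`
(`C = e^{−K₀}`, the completed-square constant of the datum; it cancels in every normalised expectation). -/
theorem exists_boltzmann_mul_density_datum_eq (g : EuclideanSpace ℝ (Fin (dimE ρ)) → ℝ) (β : ℝ)
    (ϑ : Fin (dimE ρ) → (Literature.MathematicalPhysics.QuantumLattice.ZdEdge 4 → ℝ)) :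
    ∃ C : ℝ≥0∞, C ≠ 0 ∧ C ≠ ∞ ∧ ∀ t : TSpaceD H (dimE ρ),
      (∀ e : ColdFreeIdx H, 0 < g (unscaleTE H (dimE ρ) β (t + meanTE H (dimE ρ) β ϑ) e)) →
      ENNReal.ofReal (Real.exp (-β * wilsonBoundaryAction ρ (boxEdges 4 (2 * H + 1)) (cfgTDE ρ H β ϑ t))) *
          ∏ e : ColdFreeIdx H, ENNReal.ofReal (g (unscaleTE H (dimE ρ) β (t + meanTE H (dimE ρ) β ϑ) e)) =
        C * (∏ i, gaussWeight (Qmat (fun e => e ∉ dirFreeEdges H) dirCorner (2 * H + 3)) (t i)) *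
          ENNReal.ofReal (Real.exp (tiltWDE ρ H g β ϑ t)) := by
  set K₀ : ℝ := (∑ c, (Kconst (fun e => e ∉ dirFreeEdges H) dirCorner (2 * H + 3) (sdatE β ϑ c) -
    (formM (fun e => e ∉ dirFreeEdges H) dirCorner (2 * H + 3) (sdatE β ϑ c) 0 -
      ∑ p ∈ plaquettesTouching (boxEdges 4 (2 * H + 1)),
        (sCirc (glue (pin := fun e => e ∉ dirFreeEdges H) dirCorner (2 * H + 3) (sdatE β ϑ c) 0) (p.1, p.2.1.1, p.2.1.2)) ^ 2))) / 2
    with hK₀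
  refine ⟨ENNReal.ofReal (Real.exp (-K₀)), ENNReal.ofReal_ne_zero_iff.2 (Real.exp_pos _), ENNReal.ofReal_ne_top, fun t hg => ?_⟩
  rw [← ENNReal.ofReal_prod_of_nonneg (fun e _ => (hg e).le), ← ENNReal.ofReal_mul (Real.exp_pos _).le,
    boltzmann_mul_density_datum_eq_real ρ g β ϑ t hg, prod_gaussWeight_eq_exp_qObsDE β ϑ t, ← ENNReal.ofReal_mul (by positivity),
    ← ENNReal.ofReal_mul (by positivity)]
  congr 1
  rw [← hK₀, Real.exp_add, Real.exp_neg K₀]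
  have hK : Real.exp K₀ ≠ 0 := (Real.exp_pos _).ne'
  field_simp

end Density

end Summit.QuantumFields.YangMills.Theorems.ColdBoxAllGroups

end
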